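import Mathlib
import Literature.NumberTheory.Irrationality.DirichletLValues.LinearIndependence
import Literature.NumberTheory.Transcendental.OkadaLinearIndependenceProofs
import HarnessLib

/-!
# The even Chowla–Milnor space: `dim_ℚ V_k^+(q) = φ(q)/2` exactly, and `V_k^+(q) ⊂ (2πi)^k·ℚ(e^{2πi/q})`

Topic `Literature/NumberTheory/Irrationality/DirichletLValues`. Proofs-only companion of `ChowlaMilnor.lean`
(which types the ODD space `V_k^−(q)` and Lai–Li's Theorem 1.5) and of the Okada files of
`Literature/NumberTheory/Transcendental/` (`OkadaLinearIndependence.lean`, `OkadaHurwitzBernoulliProofs.lean`,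
`OkadaLinearIndependenceProofs.lean`).  Sources, read on the page:

* S. Gun, M. R. Murty, P. Rath, *On a conjecture of Chowla and Milnor*, Canad. J. Math. **63** (2011) 1328–1344
  [GunRammurtyRath2011], Theorem 1 (p. 1332: `dim_ℚ V_k(q) ≥ φ(q)/2`, proved from Okada's theorem = Lemma 1 and
  eq. (2)) and Proposition 1 with its proof (p. 1333: the values `(ζ(k,a/q) ± ζ(k,1−a/q))/(2πi)^k` or `/iπ^k…` lie
  in the cyclotomic field);
* L. Lai, J. Li, *A partial result towards the Chowla–Milnor conjecture*, arXiv:2505.12687 [LaiLi2025], eq. (1.1)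
  p. 2: "`V_k^+(q) ⊂ (2πi)^k ℚ(e^{2πi/q})`, `dim_ℚ V_k^+(q) = φ(q)/2`", where (Definition 1.3)
  `ζ^+(k,a/q) := ζ(k,a/q) + (−1)^k ζ(k,1−a/q)` and `V_k^+(q) := Span_ℚ {ζ^+(k,a/q) : 1 ≤ a < q/2, gcd(a,q) = 1}`.

## What is proved (theorems only; no definition is introduced)

The EVEN space `V_k^+(q)` is WRITTEN OUT as
`Submodule.span ℚ {y | ∃ a, 1 ≤ a ∧ 2a < q ∧ Nat.Coprime a q ∧ y = hurwitzValue k (a/q) + (−1)^k·hurwitzValue k (1 − a/q)}`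
with the EXISTING real Hurwitz value `hurwitzValue s x = Σ_{n≥0} (n+x)^{−s}` of `LinearIndependence.lean`
(definitionally the series of the Okada fact).

* `card_halfSystem_eq`, `card_halfSystem` — `#{a < q : (a,q) = 1, 2a < q} = φ(q)/2` for `q ≥ 3` (the involution
  `a ↦ q − a` on the coprime residues has no fixed point and swaps the two halves), as a `Finset.card` and as the
  `Fintype.card` of the index type `{a : ℕ // 2a < q ∧ Nat.Coprime a q}` of the Okada fact;
* **`finrank_span_hurwitzEven`** — `dim_ℚ V_k^+(q) = φ(q)/2` for `k ≥ 2`, `q ≥ 3`: the generators are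
  `ℚ`-linearly independent by OKADA 1981 (the tree's `okada_linearIndependent_hurwitzZeta_holds`), so the
  dimension of their span is their number (`finrank_span_eq_card`);
* `hurwitzEven_mem_cyclotomic`, **`span_hurwitzEven_subset_cyclotomic`** — every generator, hence every element
  of `V_k^+(q)`, cast to `ℂ`, equals `(2πi)^k · z` with `z ∈ ℚ(e^{2πi/q})`, the latter rendered as Mathlib's
  `Algebra.adjoin ℚ {Complex.exp (2πi/q)}` (a subalgebra of `ℂ`; it is the cyclotomic field since `e^{2πi/q}` is
  algebraic, but only the subalgebra is needed): read off the Bernoulli–Fourier identity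
  `ζ(k,a/q) + (−1)^k ζ(k,−a/q) = q^{k−1}(−(2πi)^k/k!) Σ_{j mod q} 𝕖(−ja) B_k(j/q)` of the Okada file
  (`Okada.hurwitz_symm_eq_bernoulli_sum`, `Okada.ofReal_hurwitz_symm`), the character values `𝕖(m)` being powers
  of `e^{2πi/q}` and `B_k(j/q) ∈ ℚ`.

HONEST FRAMING (cell zeta5-irr / pub-zeta5): the KNOWN half of the Chowla–Milnor picture as kernel theorems
(net debt 0: no named fact is introduced or discharged); the Chowla–Milnor conjecture itself and the ODD space
`V_k^−(q)` (`ChowlaMilnor.lean`, Lai–Li Theorem 1.5) are OPEN / untouched; nothing here concerns `ζ(5)`.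
-/

noncomputable section

open Finset Complex

open scoped Nat

namespace Literature.NumberTheory.Irrationality.DirichletLValues

open Literature.NumberTheory.Transcendental

/-! ### Counting the half-system `{1 ≤ a < q/2 : (a,q) = 1}` -/

/-- For `q ≥ 3` a residue with `2a = q` is not coprime to `q` (`a ∣ q` would force `a = 1`, `q = 2`). [folklore] -/
private theorem two_mul_ne_of_coprime {q a : ℕ} (hq : 3 ≤ q) (h : Nat.Coprime q a) : 2 * a ≠ q := by
  intro h2
  have ha : a ∣ q := ⟨2, by omega⟩
  have : a = 1 := Nat.Coprime.eq_one_of_dvd h.symm ha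
  omega

/-- The involution `a ↦ q − a` matches the coprime residues below `q/2` with those above `q/2` (`q ≥ 3`, so that
`a = 0` is not coprime to `q`). [folklore] -/
private theorem card_filter_lt_eq_card_filter_gt {q : ℕ} (hq : 3 ≤ q) :
    (((range q).filter q.Coprime).filter fun a => 2 * a < q).card =
      (((range q).filter q.Coprime).filter fun a => q < 2 * a).card := by
  refine Finset.card_bij (fun a _ => q - a) ?_ ?_ ?_
  · intro a ha
    simp only [mem_filter, mem_range] at ha ⊢
    obtain ⟨⟨haq, hcop⟩, h2⟩ := ha
    have ha0 : a ≠ 0 := by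
      rintro rfl
      rw [Nat.coprime_zero_right] at hcop
      omega
    exact ⟨⟨by omega, (Nat.coprime_self_sub_right haq.le).2 hcop⟩, by omega⟩
  · intro a ha b hb h
    simp only [mem_filter, mem_range] at ha hb
    omega
  · intro b hb
    simp only [mem_filter, mem_range] at hb
    obtain ⟨⟨hbq, hcop⟩, h2⟩ := hb
    refine ⟨q - b, ?_, by omega⟩
    simp only [mem_filter, mem_range]
    exact ⟨⟨by omega, (Nat.coprime_self_sub_right hbq.le).2 hcop⟩, by omega⟩

/-- **`#{a < q : (a,q) = 1, 2a < q} = φ(q)/2`** for `q ≥ 3` — the size of the half-system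
`{1 ≤ a < q/2, gcd(a,q) = 1}` indexing the generators of `V_k^±(q)`.
[cite: LaiLi2025, Definition 1.3 and (1.1) (p. 2)] -/
theorem card_halfSystem_eq {q : ℕ} (hq : 3 ≤ q) :
    (((range q).filter q.Coprime).filter fun a => 2 * a < q).card = Nat.totient q / 2 := by
  have hsplit : ((range q).filter q.Coprime).card =
      (((range q).filter q.Coprime).filter fun a => 2 * a < q).card +
        (((range q).filter q.Coprime).filter fun a => q < 2 * a).card := by
    rw [← Finset.card_union_of_disjoint (Finset.disjoint_filter.2 fun a _ h1 h2 => by omega),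
      ← Finset.filter_or]
    congr 1
    ext a
    simp only [mem_filter, mem_range]
    constructor
    · rintro ⟨haq, hcop⟩
      refine ⟨⟨haq, hcop⟩, ?_⟩
      rcases lt_trichotomy (2 * a) q with h | h | h
      · exact Or.inl h
      · exact absurd h (two_mul_ne_of_coprime hq hcop)
      · exact Or.inr h
    · rintro ⟨h, -⟩
      exact h
  rw [Nat.totient_eq_card_coprime, hsplit, ← card_filter_lt_eq_card_filter_gt hq]
  omega

/-- The index type `{a : ℕ // 2a < q ∧ (a,q) = 1}` of the Okada fact is the filtered `Finset` above. [folklore] -/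
private theorem mem_halfSystem_iff (q a : ℕ) :
    a ∈ (((range q).filter q.Coprime).filter fun a => 2 * a < q) ↔ 2 * a < q ∧ Nat.Coprime a q := by
  simp only [mem_filter, mem_range]
  constructor
  · rintro ⟨⟨-, h⟩, h2⟩
    exact ⟨h2, h.symm⟩
  · rintro ⟨h2, h⟩
    exact ⟨⟨by omega, h.symm⟩, h2⟩

/-- `Fintype.card {a : ℕ // 2a < q ∧ (a,q) = 1} = φ(q)/2` (`q ≥ 3`), for any `Fintype` structure on the index type.
[cite: LaiLi2025, (1.1) (p. 2)] -/
theorem card_halfSystem {q : ℕ} (hq : 3 ≤ q) [Fintype {a : ℕ // 2 * a < q ∧ Nat.Coprime a q}] :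
    Fintype.card {a : ℕ // 2 * a < q ∧ Nat.Coprime a q} = Nat.totient q / 2 := by
  rw [Fintype.card_of_subtype _ (mem_halfSystem_iff q), card_halfSystem_eq hq]

/-! ### `dim_ℚ V_k^+(q) = φ(q)/2` -/

/-- **The even Chowla–Milnor space has dimension exactly `φ(q)/2`** ([LaiLi2025, (1.1)];
[GunRammurtyRath2011, Thm 1] gives `≥`): for `k ≥ 2` and `q ≥ 3`,
`dim_ℚ Span_ℚ {ζ(k,a/q) + (−1)^k ζ(k,1−a/q) : 1 ≤ a < q/2, (a,q) = 1} = φ(q)/2`,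
with `ζ(k,x) = hurwitzValue k x = Σ_{n≥0} (n+x)^{−k}`.  Proof: the `φ(q)/2` generators are `ℚ`-linearly
independent by Okada's theorem (`okada_linearIndependent_hurwitzZeta_holds`), so their span has dimension
`φ(q)/2` (`finrank_span_eq_card`, `card_halfSystem`).
[cite: LaiLi2025, (1.1) (p. 2)] [cite: GunRammurtyRath2011, Theorem 1 (p. 1332)] -/
theorem finrank_span_hurwitzEven {k q : ℕ} (hk : 2 ≤ k) (hq : 3 ≤ q) :
    Module.finrank ℚ ↥(Submodule.span ℚ {y : ℝ | ∃ a : ℕ, 1 ≤ a ∧ 2 * a < q ∧ Nat.Coprime a q ∧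
        y = hurwitzValue k ((a : ℝ) / q) + (-1 : ℝ) ^ k * hurwitzValue k (1 - (a : ℝ) / q)}) =
      Nat.totient q / 2 := by
  haveI : Fintype {a : ℕ // 2 * a < q ∧ Nat.Coprime a q} := Fintype.subtype _ (mem_halfSystem_iff q)
  have hli := okada_linearIndependent_hurwitzZeta_holds k q hk hq
  have hrange : {y : ℝ | ∃ a : ℕ, 1 ≤ a ∧ 2 * a < q ∧ Nat.Coprime a q ∧
        y = hurwitzValue k ((a : ℝ) / q) + (-1 : ℝ) ^ k * hurwitzValue k (1 - (a : ℝ) / q)} =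
      Set.range (fun a : {a : ℕ // 2 * a < q ∧ Nat.Coprime a q} =>
        (∑' n : ℕ, 1 / ((n : ℝ) + (a : ℕ) / (q : ℝ)) ^ k) +
          (-1 : ℝ) ^ k * ∑' n : ℕ, 1 / ((n : ℝ) + (1 - (a : ℕ) / (q : ℝ))) ^ k) := by
    ext y
    simp only [Set.mem_setOf_eq, Set.mem_range, hurwitzValue]
    constructor
    · rintro ⟨a, -, h2, h3, rfl⟩
      exact ⟨⟨a, h2, h3⟩, rfl⟩
    · rintro ⟨⟨a, h2, h3⟩, rfl⟩
      refine ⟨a, ?_, h2, h3, rfl⟩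
      rcases Nat.eq_zero_or_pos a with rfl | hpos
      · rw [Nat.coprime_zero_left] at h3
        omega
      · exact hpos
  rw [hrange, finrank_span_eq_card hli, card_halfSystem hq]

/-! ### `V_k^+(q) ⊂ (2πi)^k · ℚ(e^{2πi/q})` -/

/-- The additive character values are powers of `ζ_q = e^{2πi/q}`: `𝕖(x) = ζ_q^{x.val}`. [folklore] -/
private theorem stdAddChar_eq_exp_pow {q : ℕ} [NeZero q] (x : ZMod q) :
    ZMod.stdAddChar x = Complex.exp (2 * Real.pi * I / q) ^ x.val := by
  have h : ZMod.stdAddChar ((x.val : ℕ) : ZMod q) = Complex.exp (2 * Real.pi * I * x.val / q) := by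
    simpa using ZMod.stdAddChar_coe (N := q) (x.val : ℤ)
  rw [ZMod.natCast_zmod_val] at h
  rw [h, ← Complex.exp_nat_mul]
  congr 1
  ring

/-- `𝕖(x) ∈ ℚ(ζ_q)` (as a subalgebra of `ℂ`). [folklore] -/
private theorem stdAddChar_mem_adjoin {q : ℕ} [NeZero q] (x : ZMod q) :
    ZMod.stdAddChar x ∈ Algebra.adjoin ℚ ({Complex.exp (2 * Real.pi * I / q)} : Set ℂ) := by
  rw [stdAddChar_eq_exp_pow]
  exact Subalgebra.pow_mem _ (Algebra.subset_adjoin (Set.mem_singleton _)) _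

/-- The Bernoulli polynomial at the rational point `j/q` is a rational number (cast to `ℂ`). [folklore] -/
private theorem bernoulliFun_val_div_eq_cast {q : ℕ} (k : ℕ) (j : ZMod q) :
    (bernoulliFun k ((j.val : ℝ) / q) : ℂ) =
      (((Polynomial.bernoulli k).eval ((j.val : ℚ) / q) : ℚ) : ℂ) := by
  have h1 : ((j.val : ℝ) / q : ℝ) = (((j.val : ℚ) / q : ℚ) : ℝ) := by push_cast; ring
  rw [bernoulliFun, h1, Polynomial.eval_map, ← eq_ratCast (algebraMap ℚ ℝ), Polynomial.eval₂_at_apply,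
    eq_ratCast, Complex.ofReal_ratCast]

/-- **Each generator lies in `(2πi)^k·ℚ(e^{2πi/q})`**: for `k ≥ 2`, `q ≥ 1` and `0 ≤ a ≤ q`,
`ζ(k,a/q) + (−1)^k ζ(k,1−a/q) = (2πi)^k · z` with `z = −q^{k−1}/k! · Σ_{j mod q} 𝕖(−ja) B_k(j/q) ∈ ℚ(e^{2πi/q})`
(the Bernoulli–Fourier identity of the Okada file). [cite: LaiLi2025, (1.1) (p. 2)]
[cite: GunRammurtyRath2011, eq. (2) (p. 1332) and Proposition 1 with its proof (p. 1333)] -/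
theorem hurwitzEven_mem_cyclotomic {k q : ℕ} (hk : 2 ≤ k) (hq : 1 ≤ q) {a : ℕ} (ha : a ≤ q) :
    ∃ z ∈ Algebra.adjoin ℚ ({Complex.exp (2 * Real.pi * I / q)} : Set ℂ),
      (((hurwitzValue k ((a : ℝ) / q) + (-1 : ℝ) ^ k * hurwitzValue k (1 - (a : ℝ) / q) : ℝ)) : ℂ) =
        (2 * Real.pi * I) ^ k * z := by
  haveI : NeZero q := ⟨by omega⟩
  -- the rational scalar and the cyclotomic sum
  set c : ℚ := (q : ℚ) ^ (k - 1) * (-(1 / (k ! : ℚ))) with hc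
  set S : ℂ := ∑ j : ZMod q, ZMod.stdAddChar (-(j * (a : ZMod q))) *
      ((((Polynomial.bernoulli k).eval ((j.val : ℚ) / q) : ℚ)) : ℂ) with hS
  refine ⟨(c : ℂ) * S, ?_, ?_⟩
  · refine Subalgebra.mul_mem _ ?_ (Subalgebra.sum_mem _ fun j _ => Subalgebra.mul_mem _
      (stdAddChar_mem_adjoin _) ?_)
    · simpa using Subalgebra.algebraMap_mem (Algebra.adjoin ℚ ({Complex.exp (2 * Real.pi * I / q)} : Set ℂ)) c
    · simpa using Subalgebra.algebraMap_mem
        (Algebra.adjoin ℚ ({Complex.exp (2 * Real.pi * I / q)} : Set ℂ))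
        ((Polynomial.bernoulli k).eval ((j.val : ℚ) / q))
  · have h1 := Okada.ofReal_hurwitz_symm (q := q) hk ha
    have h2 := Okada.hurwitz_symm_eq_bernoulli_sum (q := q) hk (a : ZMod q)
    have hsum : ∑ j : ZMod q, ZMod.stdAddChar (-(j * (a : ZMod q))) * (bernoulliFun k ((j.val : ℝ) / q) : ℂ) =
        S := by
      refine Finset.sum_congr rfl fun j _ => ?_
      rw [bernoulliFun_val_div_eq_cast]
    have e : (((hurwitzValue k ((a : ℝ) / q) + (-1 : ℝ) ^ k * hurwitzValue k (1 - (a : ℝ) / q) : ℝ)) : ℂ) =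
        (((∑' n : ℕ, 1 / ((n : ℝ) + (a : ℕ) / (q : ℝ)) ^ k) +
          (-1 : ℝ) ^ k * ∑' n : ℕ, 1 / ((n : ℝ) + (1 - (a : ℕ) / (q : ℝ))) ^ k : ℝ) : ℂ) := rfl
    rw [e, h1, h2, hsum, hc]
    push_cast
    ring

/-- **`V_k^+(q) ⊂ (2πi)^k · ℚ(e^{2πi/q})`** ([LaiLi2025, (1.1)]): for `k ≥ 2`, `q ≥ 3`, every element of the even
Chowla–Milnor space `Span_ℚ {ζ(k,a/q) + (−1)^k ζ(k,1−a/q) : 1 ≤ a < q/2, (a,q) = 1}`, cast to `ℂ`, is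
`(2πi)^k · z` for some `z ∈ ℚ(e^{2πi/q})` (`Algebra.adjoin ℚ {exp (2πi/q)}`).
[cite: LaiLi2025, (1.1) (p. 2)] [cite: GunRammurtyRath2011, Proposition 1 and its proof (p. 1333)] -/
theorem span_hurwitzEven_subset_cyclotomic {k q : ℕ} (hk : 2 ≤ k) (hq : 3 ≤ q) {y : ℝ}
    (hy : y ∈ Submodule.span ℚ {y : ℝ | ∃ a : ℕ, 1 ≤ a ∧ 2 * a < q ∧ Nat.Coprime a q ∧
        y = hurwitzValue k ((a : ℝ) / q) + (-1 : ℝ) ^ k * hurwitzValue k (1 - (a : ℝ) / q)}) :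
    ∃ z ∈ Algebra.adjoin ℚ ({Complex.exp (2 * Real.pi * I / q)} : Set ℂ),
      (y : ℂ) = (2 * Real.pi * I) ^ k * z := by
  induction hy using Submodule.span_induction with
  | mem x hx =>
    obtain ⟨a, -, h2, -, rfl⟩ := hx
    exact hurwitzEven_mem_cyclotomic hk (by omega) (by omega)
  | zero => exact ⟨0, Subalgebra.zero_mem _, by simp⟩
  | add x y _ _ hx hy =>
    obtain ⟨z₁, hz₁, e₁⟩ := hx
    obtain ⟨z₂, hz₂, e₂⟩ := hy
    refine ⟨z₁ + z₂, Subalgebra.add_mem _ hz₁ hz₂, ?_⟩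
    push_cast
    rw [e₁, e₂]
    ring
  | smul c x _ hx =>
    obtain ⟨z, hz, e⟩ := hx
    refine ⟨(c : ℂ) * z, Subalgebra.mul_mem _ ?_ hz, ?_⟩
    · simpa using Subalgebra.algebraMap_mem (Algebra.adjoin ℚ ({Complex.exp (2 * Real.pi * I / q)} : Set ℂ)) c
    · rw [Rat.smul_def]
      push_cast
      rw [e]
      ring

end Literature.NumberTheory.Irrationality.DirichletLValues

end
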